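import Literature.MathematicalPhysics.KineticTheory.DiPernaLionsScheme
import Literature.Analysis.FluidPDE.BoltzmannEquationProofs
import Literature.Analysis.Calculus.IteratedFDerivParametricIntegral
import Literature.Analysis.Calculus.IteratedFDerivLeibnizRecursion
import Mathlib.Analysis.SpecialFunctions.JapaneseBracket
import HarnessLib

/-!
# The collision functionals of the truncated Boltzmann equation on phase-space slices

Topic: MathematicalPhysics / KineticTheory. Infrastructure for the truncated problems of the
DiPerna–Lions scheme (`truncatedProblem_globalExistence`, Cercignani–Illner–Pulvirenti 1994 §5.3
Lemma 5.3.6, pp. 145–146): the ingredients of the truncated, normalised collision operator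
`Q̃(g,g) = (1 + δ ∫ g dξ)⁻¹ Q_B(g,g)` ((3.16)) acting on a *slice* `g : E × E → ℝ` (a function
of position and velocity at a fixed time), written so that the position–velocity variable
`z = (x, v)` enters only through translates of `g`:

* `TruncPicard.mass g z = ∫ g(x, w) dw`, the local mass;
* `TruncPicard.loss B g z = ∫∫ B(u, ω) g(x, v - u) du dω` (`= (A ∗ g)(v)`, the loss frequency);
* `TruncPicard.gain B g z = ∫∫ B(u, ω) g(x, v') g(x, w') du dω`, `v' = v - ⟨u,ω⟩ω`,
  `w' = v - u + ⟨u,ω⟩ω` (the gain term after the substitution `v_* = v - u`);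
* `TruncPicard.normFactor δ g = (1 + δ mass g)⁻¹`, `TruncPicard.absorption = normFactor · loss`,
  `TruncPicard.source = normFactor · gain`.

For a Schwartz-class slice (`ContDiff ℝ ∞ g` with bounds
`(1 + ‖z‖)ᵏ ‖Dⁿ g (z)‖ ≤ C n k`) and a bounded, compactly supported measurable kernel
(`TruncPicard.KernelHyp`), these are smooth functions of `z` whose derivatives are the integrals of
the derivatives of the integrands (`Literature.Analysis.Calculus.iteratedFDeriv_integral_eq`), and
satisfy the bounds that drive the Picard iteration of Lemma 5.3.6 ("higher moments and
derivatives of `f^{n+1}` can be readily estimated in terms of those of `fⁿ`", CIP p. 146):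

* `norm_iteratedFDeriv_loss_le`: `‖Dⁿ loss‖ ≤ ‖B‖₁ sup ‖Dⁿ g‖`;
* `weight_mul_norm_iteratedFDeriv_gain_le` (**no loss of weight**): for `n ≥ 1`,
  `(1 + ‖z‖)ᵏ ‖Dⁿ gain (z)‖ ≤ ‖B‖₁ 2ᵏ⁺¹ (2 L T + 2ⁿ L²)`, where `T` bounds the weighted top
  derivative of `g` and `L` the weighted lower ones — affine in `T` (energy conservation
  `‖v‖ ≤ ‖v'‖ + ‖w'‖` moves the weight onto one factor, the kernel's compact support in `u`
  integrates the other); `weight_mul_abs_gain_le` is the order-zero form;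
* `norm_iteratedFDeriv_mass_le`: `‖Dⁿ mass‖ ≤ J_d sup (1 + ‖z‖)^{d+1} ‖Dⁿ g‖`,
  `J_d = ∫ (1 + ‖w‖)^{-(d+1)} dw`.

The kernel is never differentiated; the smooth profile of `IsSmoothTruncatedKernel` is used only
to bound it (`IsSmoothTruncatedKernel.exists_kernelHyp`).

## References

* C. Cercignani, R. Illner, M. Pulvirenti, *The Mathematical Theory of Dilute Gases*, Springer
  (1994), §5.3 (3.16)–(3.20) and Lemma 5.3.6, pp. 145–146.
* R. J. DiPerna, P.-L. Lions, Ann. of Math. 130 (1989), §IV (the approximating problems).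
-/

open MeasureTheory Metric Real Set Filter Function
open scoped InnerProductSpace ENNReal ContDiff Topology

noncomputable section

namespace Literature.MathematicalPhysics.KineticTheory

open Literature.Analysis.Calculus Literature.Analysis.FluidPDE

variable {E : Type*} [NormedAddCommGroup E] [InnerProductSpace ℝ E] [FiniteDimensional ℝ E]
  [MeasurableSpace E] [BorelSpace E]

namespace TruncPicard

/-! ## Definitions -/

variable (E) in
/-- The kernel measure `du dσ(ω)` on `E × S^{d-1}` (Lebesgue times the sphere measure
`sphereMeasure`). [folklore] -/
abbrev kernelMeasure : Measure (E × sphere (0 : E) 1) :=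
  (volume : Measure E).prod (sphereMeasure : Measure (sphere (0 : E) 1))

/-- The phase-space shift to the post-collisional velocity `v' = v - ⟨u, ω⟩ ω` of the first
particle, relative velocity `u = v - v_*`: `(0, -⟨u,ω⟩ω)`. [cite: CIPDiluteGases1994, §3.1 (3.1.2)] -/
def shift₁ (q : E × sphere (0 : E) 1) : E × E := (0, -(⟪q.1, (q.2 : E)⟫_ℝ • (q.2 : E)))

/-- The phase-space shift to the post-collisional velocity `w' = v - u + ⟨u, ω⟩ ω` of the second
particle: `(0, -u + ⟨u,ω⟩ω)`. [cite: CIPDiluteGases1994, §3.1 (3.1.2)] -/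
def shift₂ (q : E × sphere (0 : E) 1) : E × E := (0, -q.1 + ⟪q.1, (q.2 : E)⟫_ℝ • (q.2 : E))

/-- The phase-space shift to the partner velocity `v_* = v - u`: `(0, -u)`. [folklore] -/
def shiftLoss (q : E × sphere (0 : E) 1) : E × E := (0, -q.1)

/-- The total mass `‖B‖₁ = ∫∫ B(u, ω) du dω` of a (Galilean invariant) collision kernel, written
with `B(u, ω) = B((u, 0), ω)`. [folklore] -/
def kernelMass (B : E × E → sphere (0 : E) 1 → ℝ) : ℝ :=
  ∫ q, B (q.1, 0) q.2 ∂(kernelMeasure E)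

/-- The local mass `∫ g(x, w) dw` of a phase-space slice at the position of `z = (x, v)`
(the quantity normalising the truncated collision operator, CIP 1994 (3.16)). [cite: CIPDiluteGases1994, §5.3 (3.16)] -/
def mass (g : E × E → ℝ) (z : E × E) : ℝ :=
  ∫ w, g (z.1, w)

/-- The loss frequency `∫∫ B(u, ω) g(x, v - u) du dω = (A ∗ g(x, ·))(v)` of a slice
(CIP 1994 §5.3 Step 3, `R(f) = A ∗ f`). [cite: CIPDiluteGases1994, §5.3 Step 3] -/
def loss (B : E × E → sphere (0 : E) 1 → ℝ) (g : E × E → ℝ) (z : E × E) : ℝ :=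
  ∫ q, B (q.1, 0) q.2 * g (z + shiftLoss q) ∂(kernelMeasure E)

/-- The gain term `∫∫ B(u, ω) g(x, v') g(x, w') du dω` of a slice, `v' = v - ⟨u,ω⟩ω`,
`w' = v - u + ⟨u,ω⟩ω` (the gain part of `Q_B(g, g)(v)` after the substitution `v_* = v - u`;
CIP 1994 (3.1.11), §5.3 Step 6). [cite: CIPDiluteGases1994, §5.3 Step 6] -/
def gain (B : E × E → sphere (0 : E) 1 → ℝ) (g : E × E → ℝ) (z : E × E) : ℝ :=
  ∫ q, B (q.1, 0) q.2 * (g (z + shift₁ q) * g (z + shift₂ q)) ∂(kernelMeasure E)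

/-- The normalising factor `(1 + δ ∫ g(x, w) dw)⁻¹` of the truncated collision operator
(CIP 1994 (3.16), with `|g| = g` for the nonnegative slices of the scheme). [cite: CIPDiluteGases1994, §5.3 (3.16)] -/
def normFactor (δ : ℝ) (g : E × E → ℝ) (z : E × E) : ℝ :=
  (1 + δ * mass g z)⁻¹

/-- The absorption coefficient `Λ = (1 + δ ∫ g)⁻¹ (A ∗ g)` of the truncated equation written as
`∂ₜf + v·∇ₓf = Γ - Λ f`. [cite: CIPDiluteGases1994, §5.3 Step 6] -/
def absorption (δ : ℝ) (B : E × E → sphere (0 : E) 1 → ℝ) (g : E × E → ℝ) (z : E × E) : ℝ :=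
  normFactor δ g z * loss B g z

/-- The source `Γ = (1 + δ ∫ g)⁻¹ Q⁺_B(g, g)` of the truncated equation written as
`∂ₜf + v·∇ₓf = Γ - Λ f`. [cite: CIPDiluteGases1994, §5.3 Step 6] -/
def source (δ : ℝ) (B : E × E → sphere (0 : E) 1 → ℝ) (g : E × E → ℝ) (z : E × E) : ℝ :=
  normFactor δ g z * gain B g z

/-- *Bounded, compactly supported collision kernels*: the properties of the truncated kernels of
CIP 1994 §5.3 Step 6 that the slice functionals use — measurable, nonnegative, Galilean
invariant, bounded by `M`, vanishing for relative velocities of norm `≥ R`. [cite: CIPDiluteGases1994, §5.3 Step 6] -/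
structure KernelHyp (B : E × E → sphere (0 : E) 1 → ℝ) (M R : ℝ) : Prop where
  /-- Joint measurability. -/
  measurable : Measurable (Function.uncurry B)
  /-- `B ≥ 0`. -/
  nonneg : ∀ p om, 0 ≤ B p om
  /-- Galilean invariance. -/
  galilean : ∀ (v w u : E) om, B (v + u, w + u) om = B (v, w) om
  /-- `M ≥ 0`. -/
  bound_nonneg : 0 ≤ M
  /-- `B ≤ M`. -/
  le : ∀ z om, B (z, 0) om ≤ M
  /-- `B(u, ω) = 0` for `‖u‖ ≥ R`. -/
  eq_zero : ∀ z om, R ≤ ‖z‖ → B (z, 0) om = 0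

/-! ## The kernel -/

section Kernel

variable {B : E × E → sphere (0 : E) 1 → ℝ} {M R : ℝ}

omit [InnerProductSpace ℝ E] [FiniteDimensional ℝ E] [BorelSpace E] in
/-- Galilean invariance: `B(v, w, ω) = B(v - w, 0, ω)`. [folklore] -/
theorem KernelHyp.apply_eq (h : KernelHyp B M R) (v w : E) (om : sphere (0 : E) 1) :
    B (v, w) om = B (v - w, 0) om := by
  have := h.galilean (v - w) 0 w om
  rw [sub_add_cancel, zero_add] at this
  exact this

/-- The smooth truncated kernels of the DiPerna–Lions scheme are bounded compactly supported
kernels. [folklore] -/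
theorem _root_.Literature.MathematicalPhysics.KineticTheory.IsSmoothTruncatedKernel.exists_kernelHyp
    {δ : ℝ} (hB : IsSmoothTruncatedKernel δ B) : ∃ M R : ℝ, KernelHyp B M R := by
  obtain ⟨b, hb, hbB⟩ := hB.smooth
  obtain ⟨R, hR⟩ := hB.eq_zero_of_le
  -- bound `b` on the compact set `closedBall 0 R × sphere 0 1 ⊆ E × E`
  have hK : IsCompact (closedBall (0 : E) R ×ˢ Metric.sphere (0 : E) 1) :=
    (isCompact_closedBall 0 R).prod (isCompact_sphere 0 1)
  obtain ⟨M, hM⟩ := hK.exists_bound_of_continuousOn (f := b) hb.continuous.continuousOn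
  refine ⟨max M 0, R, ⟨hB.isDiPernaLionsKernel.measurable, hB.isDiPernaLionsKernel.nonneg,
    hB.isDiPernaLionsKernel.sub_right, le_max_right _ _, fun z om => ?_, hR⟩⟩
  rcases lt_or_ge ‖z‖ R with hz | hz
  · have hmem : (z, (om : E)) ∈ closedBall (0 : E) R ×ˢ Metric.sphere (0 : E) 1 :=
      ⟨mem_closedBall_zero_iff.2 hz.le, om.2⟩
    have h1 := hM _ hmem
    rw [hbB (z, 0) om, sub_zero]
    exact (le_of_abs_le (Real.norm_eq_abs _ ▸ h1)).trans (le_max_left _ _)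
  · rw [hR z om hz]
    exact le_max_right _ _

omit [InnerProductSpace ℝ E] [FiniteDimensional ℝ E] [BorelSpace E] in
/-- Measurability of `q ↦ B(q.1, 0, q.2)`. [folklore] -/
theorem KernelHyp.measurable_kernel (h : KernelHyp B M R) :
    Measurable fun q : E × sphere (0 : E) 1 => B (q.1, 0) q.2 :=
  h.measurable.comp ((measurable_fst.prodMk measurable_const).prodMk measurable_snd)

omit [InnerProductSpace ℝ E] [FiniteDimensional ℝ E] [BorelSpace E] in
/-- The kernel is dominated by `M 1_{‖u‖ ≤ R}`. [folklore] -/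
theorem KernelHyp.norm_le_indicator (h : KernelHyp B M R) (q : E × sphere (0 : E) 1) :
    ‖B (q.1, 0) q.2‖ ≤ (closedBall (0 : E) R).indicator (fun _ => M) q.1 := by
  rw [Real.norm_of_nonneg (h.nonneg _ _)]
  by_cases hq : q.1 ∈ closedBall (0 : E) R
  · rw [indicator_of_mem hq]; exact h.le _ _
  · rw [indicator_of_notMem hq, h.eq_zero _ _ (le_of_lt (by simpa using hq))]

/-- The kernel is integrable on `E × S^{d-1}`. [folklore] -/
theorem KernelHyp.integrable (h : KernelHyp B M R) :
    Integrable (fun q : E × sphere (0 : E) 1 => B (q.1, 0) q.2) (kernelMeasure E) := by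
  haveI := isFiniteMeasure_sphereMeasure (E := E)
  have hdom : Integrable (fun q : E × sphere (0 : E) 1 =>
      (closedBall (0 : E) R).indicator (fun _ => M) q.1 * (1 : ℝ)) (kernelMeasure E) := by
    refine Integrable.mul_prod ?_ (integrable_const (1 : ℝ))
    exact (integrableOn_const (measure_closedBall_lt_top (x := (0 : E)) (r := R)).ne).integrable_indicator
      measurableSet_closedBall
  refine hdom.mono' h.measurable_kernel.aestronglyMeasurable (Eventually.of_forall fun q => ?_)
  rw [mul_one]
  exact h.norm_le_indicator q

/-- The kernel times a bounded measurable function is integrable. [folklore] -/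
theorem KernelHyp.integrable_mul (h : KernelHyp B M R) {φ : E × sphere (0 : E) 1 → ℝ}
    (hφ : AEStronglyMeasurable φ (kernelMeasure E)) {K : ℝ} (hK : ∀ q, ‖φ q‖ ≤ K) :
    Integrable (fun q : E × sphere (0 : E) 1 => B (q.1, 0) q.2 * φ q) (kernelMeasure E) :=
  h.integrable.mul_bdd hφ (Eventually.of_forall hK)

/-- `‖B‖₁ ≥ 0`. [folklore] -/
theorem KernelHyp.kernelMass_nonneg (h : KernelHyp B M R) : 0 ≤ kernelMass B :=
  integral_nonneg fun _ => h.nonneg _ _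

/-- `∫ B φ ≤ ‖B‖₁ K` for `φ ≤ K`. [folklore] -/
theorem KernelHyp.integral_mul_le (h : KernelHyp B M R) {φ : E × sphere (0 : E) 1 → ℝ}
    (hφ : AEStronglyMeasurable φ (kernelMeasure E)) {K : ℝ} (hK : ∀ q, ‖φ q‖ ≤ K) :
    ∫ q, B (q.1, 0) q.2 * φ q ∂(kernelMeasure E) ≤ kernelMass B * K := by
  rw [kernelMass, ← integral_mul_const]
  refine integral_mono (h.integrable_mul hφ hK) (h.integrable.mul_const K) fun q => ?_
  exact mul_le_mul_of_nonneg_left ((le_abs_self _).trans (Real.norm_eq_abs _ ▸ hK q)) (h.nonneg _ _)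

/-- `‖∫ B φ‖ ≤ ‖B‖₁ K` for `‖φ‖ ≤ K`. [folklore] -/
theorem KernelHyp.norm_integral_mul_le (h : KernelHyp B M R) {φ : E × sphere (0 : E) 1 → ℝ}
    {K : ℝ} (hK : ∀ q, ‖φ q‖ ≤ K) :
    ‖∫ q, B (q.1, 0) q.2 * φ q ∂(kernelMeasure E)‖ ≤ kernelMass B * K := by
  rw [kernelMass, ← integral_mul_const]
  refine norm_integral_le_of_norm_le (h.integrable.mul_const K) (Eventually.of_forall fun q => ?_)
  rw [norm_mul, Real.norm_of_nonneg (h.nonneg _ _)]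
  exact mul_le_mul_of_nonneg_left (hK q) (h.nonneg _ _)

end Kernel

/-! ## The shifts and the weights -/

section Shifts

omit [FiniteDimensional ℝ E] [MeasurableSpace E] [BorelSpace E]

/-- Continuity of `shift₁`. [folklore] -/
@[fun_prop]
theorem continuous_shift₁ : Continuous (shift₁ : E × sphere (0 : E) 1 → E × E) := by
  unfold shift₁; fun_prop

/-- Continuity of `shift₂`. [folklore] -/
@[fun_prop]
theorem continuous_shift₂ : Continuous (shift₂ : E × sphere (0 : E) 1 → E × E) := by
  unfold shift₂; fun_prop

omit [InnerProductSpace ℝ E] in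
/-- Continuity of `shiftLoss`. [folklore] -/
@[fun_prop]
theorem continuous_shiftLoss : Continuous (shiftLoss : E × sphere (0 : E) 1 → E × E) := by
  unfold shiftLoss; fun_prop

/-- The shifted velocities are the post-collisional velocities of the pair `(v, v - u)`. [folklore] -/
theorem add_shift_eq_collide (z : E × E) (q : E × sphere (0 : E) 1) :
    (z + shift₁ q).2 = (collide q.2 (z.2, z.2 - q.1)).1 ∧
      (z + shift₂ q).2 = (collide q.2 (z.2, z.2 - q.1)).2 ∧
      (z + shift₁ q).1 = z.1 ∧ (z + shift₂ q).1 = z.1 := by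
  simp only [shift₁, shift₂, collide, Prod.snd_add, Prod.fst_add, add_zero, sub_sub_cancel]
  refine ⟨by abel, by abel, trivial, trivial⟩

/-- **Energy conservation moves the weight onto one factor**:
`‖z‖ ≤ ‖z + shift₁ q‖ + ‖z + shift₂ q‖` (from `‖v‖² ≤ ‖v'‖² + ‖w'‖²`). [cite: CIPDiluteGases1994, §3.1] -/
theorem norm_le_norm_add_shift (z : E × E) (q : E × sphere (0 : E) 1) :
    ‖z‖ ≤ ‖z + shift₁ q‖ + ‖z + shift₂ q‖ := by
  obtain ⟨h1, h2, h3, h4⟩ := add_shift_eq_collide z q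
  have hen := norm_sq_collide_fst_add_norm_sq_collide_snd q.2 (z.2, z.2 - q.1)
  set v' := (collide q.2 (z.2, z.2 - q.1)).1
  set w' := (collide q.2 (z.2, z.2 - q.1)).2
  have hv : ‖z.2‖ ≤ ‖v'‖ + ‖w'‖ := by
    have hsq : ‖z.2‖ ^ 2 ≤ (‖v'‖ + ‖w'‖) ^ 2 := by
      nlinarith [hen, norm_nonneg v', norm_nonneg w', sq_nonneg ‖z.2 - q.1‖]
    exact (pow_le_pow_iff_left₀ (norm_nonneg _) (by positivity) two_ne_zero).1 hsq
  have hx1 : ‖z.1‖ ≤ ‖z + shift₁ q‖ := by rw [← h3]; exact norm_fst_le _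
  have hv1 : ‖v'‖ ≤ ‖z + shift₁ q‖ := by rw [← h1]; exact norm_snd_le _
  have hw2 : ‖w'‖ ≤ ‖z + shift₂ q‖ := by rw [← h2]; exact norm_snd_le _
  rw [Prod.norm_def]
  refine max_le ?_ ?_
  · exact hx1.trans (le_add_of_nonneg_right (norm_nonneg _))
  · exact hv.trans (add_le_add hv1 hw2)

/-- The additive splitting of polynomial weights across a collision:
`(1 + ‖z‖)ᵏ ≤ 2ᵏ ((1 + ‖z + shift₁ q‖)ᵏ + (1 + ‖z + shift₂ q‖)ᵏ)`. [folklore] -/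
theorem weight_le_add_shift (z : E × E) (q : E × sphere (0 : E) 1) (k : ℕ) :
    (1 + ‖z‖) ^ k ≤ 2 ^ k * ((1 + ‖z + shift₁ q‖) ^ k + (1 + ‖z + shift₂ q‖) ^ k) := by
  set a : ℝ := 1 + ‖z + shift₁ q‖
  set b : ℝ := 1 + ‖z + shift₂ q‖
  have ha : 1 ≤ a := le_add_of_nonneg_right (norm_nonneg _)
  have hb : 1 ≤ b := le_add_of_nonneg_right (norm_nonneg _)
  have hle : 1 + ‖z‖ ≤ 2 * max a b := by
    have := norm_le_norm_add_shift z q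
    have hma : a ≤ max a b := le_max_left _ _
    have hmb : b ≤ max a b := le_max_right _ _
    linarith
  calc (1 + ‖z‖) ^ k ≤ (2 * max a b) ^ k := pow_le_pow_left₀ (by positivity) hle k
    _ = 2 ^ k * (max a b) ^ k := mul_pow _ _ _
    _ ≤ 2 ^ k * (a ^ k + b ^ k) := by
        refine mul_le_mul_of_nonneg_left ?_ (by positivity)
        rcases le_total a b with hab | hab
        · rw [max_eq_right hab]; linarith [pow_nonneg (zero_le_one.trans ha) k]
        · rw [max_eq_left hab]; linarith [pow_nonneg (zero_le_one.trans hb) k]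

end Shifts

/-! ## Schwartz-type slices: elementary consequences of the bounds -/

section Slice

omit [FiniteDimensional ℝ E] [MeasurableSpace E] [BorelSpace E]

variable {g : E × E → ℝ} {C : ℕ → ℕ → ℝ}

/-- The constants of a family of weighted bounds are nonnegative. [folklore] -/
theorem bound_nonneg (hC : ∀ (n k : ℕ) (z : E × E), (1 + ‖z‖) ^ k * ‖iteratedFDeriv ℝ n g z‖ ≤ C n k)
    (n k : ℕ) : 0 ≤ C n k :=
  le_trans (mul_nonneg (by positivity) (norm_nonneg _)) (hC n k 0)

/-- Unweighted bounds from weighted ones. [folklore] -/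
theorem norm_iteratedFDeriv_le_of_weight {k : ℕ} {T : ℝ} {n : ℕ}
    (hT : ∀ z : E × E, (1 + ‖z‖) ^ k * ‖iteratedFDeriv ℝ n g z‖ ≤ T) (z : E × E) :
    ‖iteratedFDeriv ℝ n g z‖ ≤ T := by
  have h1 : (1 : ℝ) ≤ (1 + ‖z‖) ^ k := one_le_pow₀ (le_add_of_nonneg_right (norm_nonneg _))
  calc ‖iteratedFDeriv ℝ n g z‖ = 1 * ‖iteratedFDeriv ℝ n g z‖ := (one_mul _).symm
    _ ≤ (1 + ‖z‖) ^ k * ‖iteratedFDeriv ℝ n g z‖ := mul_le_mul_of_nonneg_right h1 (norm_nonneg _)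
    _ ≤ T := hT z

/-- Lower weights from higher ones. [folklore] -/
theorem weight_mono {k k' : ℕ} (hk : k ≤ k') {T : ℝ} {n : ℕ}
    (hT : ∀ z : E × E, (1 + ‖z‖) ^ k' * ‖iteratedFDeriv ℝ n g z‖ ≤ T) (z : E × E) :
    (1 + ‖z‖) ^ k * ‖iteratedFDeriv ℝ n g z‖ ≤ T :=
  le_trans (mul_le_mul_of_nonneg_right (pow_le_pow_right₀ (le_add_of_nonneg_right (norm_nonneg _))
    hk) (norm_nonneg _)) (hT z)

/-- `|g(z)| ≤ C 0 0`. [folklore] -/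
theorem abs_le_of_bounds (hC : ∀ (n k : ℕ) (z : E × E), (1 + ‖z‖) ^ k * ‖iteratedFDeriv ℝ n g z‖ ≤ C n k)
    (z : E × E) : |g z| ≤ C 0 0 := by
  have := hC 0 0 z
  rwa [pow_zero, one_mul, norm_iteratedFDeriv_zero, Real.norm_eq_abs] at this

/-- Pointwise decay: `‖Dⁿ g (z)‖ ≤ C n k / (1 + ‖z‖)ᵏ`. [folklore] -/
theorem norm_iteratedFDeriv_le_div
    (hC : ∀ (n k : ℕ) (z : E × E), (1 + ‖z‖) ^ k * ‖iteratedFDeriv ℝ n g z‖ ≤ C n k)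
    (n k : ℕ) (z : E × E) : ‖iteratedFDeriv ℝ n g z‖ ≤ C n k / (1 + ‖z‖) ^ k := by
  rw [le_div_iff₀ (by positivity), mul_comm]
  exact hC n k z

end Slice

/-! ## The loss frequency -/

section Loss

variable {B : E × E → sphere (0 : E) 1 → ℝ} {M R : ℝ} {g : E × E → ℝ} {C : ℕ → ℕ → ℝ}

/-- The hypotheses of iterated differentiation under the integral sign for the loss integrand
`q ↦ (z ↦ B(u,om) g(z + shiftLoss q))`. [folklore] -/
theorem loss_family (h : KernelHyp B M R) (hg : ContDiff ℝ ∞ g)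
    (hC : ∀ (n k : ℕ) (z : E × E), (1 + ‖z‖) ^ k * ‖iteratedFDeriv ℝ n g z‖ ≤ C n k) :
    (∀ q : E × sphere (0 : E) 1, ContDiff ℝ ∞ fun z : E × E => B (q.1, 0) q.2 * g (z + shiftLoss q)) ∧
    (∀ (n : ℕ) (z : E × E), AEStronglyMeasurable (fun q : E × sphere (0 : E) 1 =>
      iteratedFDeriv ℝ n (fun z : E × E => B (q.1, 0) q.2 * g (z + shiftLoss q)) z) (kernelMeasure E)) ∧
    (∀ n : ℕ, ∃ G : E × sphere (0 : E) 1 → ℝ, Integrable G (kernelMeasure E) ∧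
      ∀ q z, ‖iteratedFDeriv ℝ n (fun z : E × E => B (q.1, 0) q.2 * g (z + shiftLoss q)) z‖ ≤ G q) := by
  have hformula : ∀ (n : ℕ) (q : E × sphere (0 : E) 1) (z : E × E),
      iteratedFDeriv ℝ n (fun z : E × E => B (q.1, 0) q.2 * g (z + shiftLoss q)) z =
        B (q.1, 0) q.2 • iteratedFDeriv ℝ n g (z + shiftLoss q) := by
    intro n q z
    have hsm : ContDiff ℝ ∞ fun z : E × E => g (z + shiftLoss q) := hg.comp (contDiff_id.add contDiff_const)
    have e : (fun z : E × E => B (q.1, 0) q.2 * g (z + shiftLoss q)) =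
        fun z => B (q.1, 0) q.2 • g (z + shiftLoss q) := rfl
    rw [e, iteratedFDeriv_const_smul_apply' (hsm.of_le (mod_cast le_top)).contDiffAt, iteratedFDeriv_comp_add_right]
  refine ⟨fun q => contDiff_const.mul (hg.comp (contDiff_id.add contDiff_const)), fun n z => ?_,
    fun n => ⟨fun q => B (q.1, 0) q.2 * C n 0, h.integrable.mul_const _, fun q z => ?_⟩⟩
  · simp_rw [hformula n]
    exact h.measurable_kernel.aestronglyMeasurable.smul
      (((hg.continuous_iteratedFDeriv (mod_cast le_top)).comp
        (continuous_const.add continuous_shiftLoss)).aestronglyMeasurable)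
  · rw [hformula, norm_smul, Real.norm_of_nonneg (h.nonneg _ _)]
    exact mul_le_mul_of_nonneg_left (norm_iteratedFDeriv_le_of_weight (fun y => hC n 0 y) _) (h.nonneg _ _)

/-- **The loss frequency of a Schwartz-type slice is smooth.** [folklore] -/
theorem contDiff_loss (h : KernelHyp B M R) (hg : ContDiff ℝ ∞ g)
    (hC : ∀ (n k : ℕ) (z : E × E), (1 + ‖z‖) ^ k * ‖iteratedFDeriv ℝ n g z‖ ≤ C n k) :
    ContDiff ℝ ∞ (loss B g) := by
  obtain ⟨h1, h2, h3⟩ := loss_family h hg hC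
  exact contDiff_integral_of_dominated_iteratedFDeriv h1 h2 h3

/-- **Derivative bound for the loss frequency**: `‖Dⁿ loss (z)‖ ≤ ‖B‖₁ T` whenever
`‖Dⁿ g‖ ≤ T` everywhere (the derivatives fall on `g`, the kernel has finite mass). [folklore] -/
theorem norm_iteratedFDeriv_loss_le (h : KernelHyp B M R) (hg : ContDiff ℝ ∞ g)
    (hC : ∀ (n k : ℕ) (z : E × E), (1 + ‖z‖) ^ k * ‖iteratedFDeriv ℝ n g z‖ ≤ C n k)
    {n : ℕ} {T : ℝ} (hT : ∀ y, ‖iteratedFDeriv ℝ n g y‖ ≤ T) (z : E × E) :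
    ‖iteratedFDeriv ℝ n (loss B g) z‖ ≤ kernelMass B * T := by
  obtain ⟨h1, h2, h3⟩ := loss_family h hg hC
  have hT0 : 0 ≤ T := (norm_nonneg _).trans (hT 0)
  rw [show loss B g = fun z => ∫ q, B (q.1, 0) q.2 * g (z + shiftLoss q) ∂(kernelMeasure E) from rfl,
    iteratedFDeriv_integral_eq h1 h2 h3]
  have hformula : ∀ q : E × sphere (0 : E) 1,
      iteratedFDeriv ℝ n (fun z : E × E => B (q.1, 0) q.2 * g (z + shiftLoss q)) z =
        B (q.1, 0) q.2 • iteratedFDeriv ℝ n g (z + shiftLoss q) := by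
    intro q
    have hsm : ContDiff ℝ ∞ fun z : E × E => g (z + shiftLoss q) := hg.comp (contDiff_id.add contDiff_const)
    have e : (fun z : E × E => B (q.1, 0) q.2 * g (z + shiftLoss q)) =
        fun z => B (q.1, 0) q.2 • g (z + shiftLoss q) := rfl
    rw [e, iteratedFDeriv_const_smul_apply' (hsm.of_le (mod_cast le_top)).contDiffAt, iteratedFDeriv_comp_add_right]
  simp_rw [hformula]
  rw [kernelMass, ← integral_mul_const]
  refine norm_integral_le_of_norm_le (h.integrable.mul_const T) (Eventually.of_forall fun q => ?_)
  rw [norm_smul, Real.norm_of_nonneg (h.nonneg _ _)]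
  exact mul_le_mul_of_nonneg_left (hT _) (h.nonneg _ _)

/-- The loss frequency of a nonnegative slice is nonnegative. [folklore] -/
theorem loss_nonneg (h : KernelHyp B M R) (hg0 : ∀ z, 0 ≤ g z) (z : E × E) : 0 ≤ loss B g z :=
  integral_nonneg fun _ => mul_nonneg (h.nonneg _ _) (hg0 _)

/-- Sup bound for the loss frequency: `loss (z) ≤ ‖B‖₁ C₀` if `|g| ≤ C₀`. [folklore] -/
theorem loss_le (h : KernelHyp B M R) (hgc : Continuous g) {C₀ : ℝ} (h0 : ∀ y, |g y| ≤ C₀)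
    (z : E × E) : loss B g z ≤ kernelMass B * C₀ :=
  h.integral_mul_le ((hgc.comp (continuous_const.add continuous_shiftLoss)).aestronglyMeasurable)
    fun q => by rw [Real.norm_eq_abs]; exact h0 _

end Loss

/-! ## The gain term -/

section Gain

variable {B : E × E → sphere (0 : E) 1 → ℝ} {M R : ℝ} {g : E × E → ℝ} {C : ℕ → ℕ → ℝ}

omit [FiniteDimensional ℝ E] [MeasurableSpace E] [BorelSpace E] in
/-- The product `g(z + shift₁ q) g(z + shift₂ q)` is one smooth function of `(z, z)` evaluated
along an affine map depending on `q`. [folklore] -/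
theorem gain_integrand_eq_comp_affine (g : E × E → ℝ) (q : E × sphere (0 : E) 1) :
    (fun z : E × E => g (z + shift₁ q) * g (z + shift₂ q)) = fun z : E × E =>
      (fun y : (E × E) × (E × E) => g y.1 * g y.2)
        (((ContinuousLinearMap.id ℝ (E × E)).prod (ContinuousLinearMap.id ℝ (E × E))) z +
          (shift₁ q, shift₂ q)) := by
  funext z
  rfl

omit [FiniteDimensional ℝ E] [MeasurableSpace E] [BorelSpace E] in
/-- The derivatives of the gain integrand. [folklore] -/
theorem iteratedFDeriv_gain_integrand (hg : ContDiff ℝ ∞ g) (n : ℕ) (q : E × sphere (0 : E) 1)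
    (z : E × E) :
    iteratedFDeriv ℝ n (fun z : E × E => B (q.1, 0) q.2 * (g (z + shift₁ q) * g (z + shift₂ q))) z =
      B (q.1, 0) q.2 • iteratedFDeriv ℝ n (fun z : E × E => g (z + shift₁ q) * g (z + shift₂ q)) z := by
  have hsm : ContDiff ℝ ∞ fun z : E × E => g (z + shift₁ q) * g (z + shift₂ q) :=
    (hg.comp (contDiff_id.add contDiff_const)).mul (hg.comp (contDiff_id.add contDiff_const))
  have e : (fun z : E × E => B (q.1, 0) q.2 * (g (z + shift₁ q) * g (z + shift₂ q))) =
      fun z => B (q.1, 0) q.2 • (g (z + shift₁ q) * g (z + shift₂ q)) := rfl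
  rw [e, iteratedFDeriv_const_smul_apply' (hsm.of_le (mod_cast le_top)).contDiffAt]

omit [FiniteDimensional ℝ E] [MeasurableSpace E] [BorelSpace E] in
/-- Leibniz bound for the product of the two translates:
`‖Dⁿ[g(· + s₁) g(· + s₂)](z)‖ ≤ ∑ᵢ C(n,i) ‖Dⁱg(z + s₁)‖ ‖Dⁿ⁻ⁱg(z + s₂)‖`. [folklore] -/
theorem norm_iteratedFDeriv_gain_prod_le (hg : ContDiff ℝ ∞ g) (n : ℕ) (q : E × sphere (0 : E) 1)
    (z : E × E) :
    ‖iteratedFDeriv ℝ n (fun z : E × E => g (z + shift₁ q) * g (z + shift₂ q)) z‖ ≤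
      ∑ i ∈ Finset.range (n + 1), (n.choose i : ℝ) * ‖iteratedFDeriv ℝ i g (z + shift₁ q)‖ *
        ‖iteratedFDeriv ℝ (n - i) g (z + shift₂ q)‖ := by
  have h1 : ContDiff ℝ ∞ fun z : E × E => g (z + shift₁ q) := hg.comp (contDiff_id.add contDiff_const)
  have h2 : ContDiff ℝ ∞ fun z : E × E => g (z + shift₂ q) := hg.comp (contDiff_id.add contDiff_const)
  refine (norm_iteratedFDeriv_mul_le h1 h2 z (mod_cast le_top)).trans (le_of_eq ?_)
  refine Finset.sum_congr rfl fun i _ => ?_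
  rw [iteratedFDeriv_comp_add_right, iteratedFDeriv_comp_add_right]

/-- The hypotheses of iterated differentiation under the integral sign for the gain integrand.
[folklore] -/
theorem gain_family (h : KernelHyp B M R) (hg : ContDiff ℝ ∞ g)
    (hC : ∀ (n k : ℕ) (z : E × E), (1 + ‖z‖) ^ k * ‖iteratedFDeriv ℝ n g z‖ ≤ C n k) :
    (∀ q : E × sphere (0 : E) 1, ContDiff ℝ ∞ fun z : E × E =>
      B (q.1, 0) q.2 * (g (z + shift₁ q) * g (z + shift₂ q))) ∧
    (∀ (n : ℕ) (z : E × E), AEStronglyMeasurable (fun q : E × sphere (0 : E) 1 =>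
      iteratedFDeriv ℝ n (fun z : E × E => B (q.1, 0) q.2 * (g (z + shift₁ q) * g (z + shift₂ q))) z)
      (kernelMeasure E)) ∧
    (∀ n : ℕ, ∃ G : E × sphere (0 : E) 1 → ℝ, Integrable G (kernelMeasure E) ∧
      ∀ q z, ‖iteratedFDeriv ℝ n (fun z : E × E =>
        B (q.1, 0) q.2 * (g (z + shift₁ q) * g (z + shift₂ q))) z‖ ≤ G q) := by
  have hΨ : ContDiff ℝ ∞ fun y : (E × E) × (E × E) => g y.1 * g y.2 :=
    (hg.comp contDiff_fst).mul (hg.comp contDiff_snd)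
  refine ⟨fun q => contDiff_const.mul ((hg.comp (contDiff_id.add contDiff_const)).mul
    (hg.comp (contDiff_id.add contDiff_const))), fun n z => ?_, fun n => ?_⟩
  · simp_rw [iteratedFDeriv_gain_integrand hg, gain_integrand_eq_comp_affine g]
    refine h.measurable_kernel.aestronglyMeasurable.smul ?_
    exact (continuous_iteratedFDeriv_comp_affine_param hΨ _
      (continuous_shift₁.prodMk continuous_shift₂) n z).aestronglyMeasurable
  · -- `‖Dⁿ(H q) z‖ ≤ B(q) 2ⁿ Sₙ²`, `Sₙ = ∑_{j ≤ n} C j 0`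
    set S : ℝ := ∑ j ∈ Finset.range (n + 1), C j 0 with hS
    have hCS : ∀ j ≤ n, C j 0 ≤ S := fun j hj =>
      Finset.single_le_sum (fun i _ => bound_nonneg hC i 0) (Finset.mem_range.2 (Nat.lt_succ_of_le hj))
    refine ⟨fun q => B (q.1, 0) q.2 * (2 ^ n * S * S), h.integrable.mul_const _, fun q z => ?_⟩
    rw [iteratedFDeriv_gain_integrand hg, norm_smul, Real.norm_of_nonneg (h.nonneg _ _)]
    refine mul_le_mul_of_nonneg_left ((norm_iteratedFDeriv_gain_prod_le hg n q z).trans ?_) (h.nonneg _ _)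
    exact sum_choose_mul_le (fun i _ => norm_nonneg _)
      (fun i hi => (norm_iteratedFDeriv_le_of_weight (fun y => hC i 0 y) _).trans (hCS i hi))
      (fun i _ => norm_nonneg _)
      (fun i hi => (norm_iteratedFDeriv_le_of_weight (fun y => hC i 0 y) _).trans (hCS i hi))

/-- **The gain term of a Schwartz-type slice is smooth.** [folklore] -/
theorem contDiff_gain (h : KernelHyp B M R) (hg : ContDiff ℝ ∞ g)
    (hC : ∀ (n k : ℕ) (z : E × E), (1 + ‖z‖) ^ k * ‖iteratedFDeriv ℝ n g z‖ ≤ C n k) :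
    ContDiff ℝ ∞ (gain B g) := by
  obtain ⟨h1, h2, h3⟩ := gain_family h hg hC
  exact contDiff_integral_of_dominated_iteratedFDeriv h1 h2 h3

/-- The derivatives of the gain term are dominated by the kernel integral of the weighted
Leibniz sums. [folklore] -/
theorem norm_iteratedFDeriv_gain_le_integral (h : KernelHyp B M R) (hg : ContDiff ℝ ∞ g)
    (hC : ∀ (n k : ℕ) (z : E × E), (1 + ‖z‖) ^ k * ‖iteratedFDeriv ℝ n g z‖ ≤ C n k)
    (n : ℕ) (z : E × E) {K : ℝ}
    (hK : ∀ q : E × sphere (0 : E) 1, ∑ i ∈ Finset.range (n + 1), (n.choose i : ℝ) *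
      ‖iteratedFDeriv ℝ i g (z + shift₁ q)‖ * ‖iteratedFDeriv ℝ (n - i) g (z + shift₂ q)‖ ≤ K) :
    ‖iteratedFDeriv ℝ n (gain B g) z‖ ≤ kernelMass B * K := by
  obtain ⟨h1, h2, h3⟩ := gain_family h hg hC
  rw [show gain B g = fun z => ∫ q, B (q.1, 0) q.2 * (g (z + shift₁ q) * g (z + shift₂ q))
    ∂(kernelMeasure E) from rfl, iteratedFDeriv_integral_eq h1 h2 h3]
  simp_rw [iteratedFDeriv_gain_integrand hg]
  rw [kernelMass, ← integral_mul_const]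
  refine norm_integral_le_of_norm_le (h.integrable.mul_const K) (Eventually.of_forall fun q => ?_)
  rw [norm_smul, Real.norm_of_nonneg (h.nonneg _ _)]
  exact mul_le_mul_of_nonneg_left ((norm_iteratedFDeriv_gain_prod_le hg n q z).trans (hK q)) (h.nonneg _ _)

/-- **Weighted derivative bound for the gain term, no loss of weight** (the estimate behind CIP's
"higher moments and derivatives of `f^{n+1}` can be readily estimated in terms of those of `fⁿ`",
p. 146): for `n ≥ 1`, if `(1 + ‖y‖)ᵏ ‖Dⁱ g (y)‖ ≤ L` for all `i < n` and
`(1 + ‖y‖)ᵏ ‖Dⁿ g (y)‖ ≤ T`, then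
`(1 + ‖z‖)ᵏ ‖Dⁿ gain (z)‖ ≤ ‖B‖₁ 2ᵏ⁺¹ (2 L T + 2ⁿ L²)` — affine in the top order `T`. [cite: CIPDiluteGases1994, §5.3 Lemma 5.3.6 (p. 146)] -/
theorem weight_mul_norm_iteratedFDeriv_gain_le (h : KernelHyp B M R)
    (hg : ContDiff ℝ ∞ g)
    (hC : ∀ (n k : ℕ) (z : E × E), (1 + ‖z‖) ^ k * ‖iteratedFDeriv ℝ n g z‖ ≤ C n k)
    {n k : ℕ} (hn : 1 ≤ n) {L T : ℝ}
    (hL : ∀ i < n, ∀ y : E × E, (1 + ‖y‖) ^ k * ‖iteratedFDeriv ℝ i g y‖ ≤ L)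
    (hT : ∀ y : E × E, (1 + ‖y‖) ^ k * ‖iteratedFDeriv ℝ n g y‖ ≤ T) (z : E × E) :
    (1 + ‖z‖) ^ k * ‖iteratedFDeriv ℝ n (gain B g) z‖ ≤
      kernelMass B * (2 ^ (k + 1) * (2 * L * T + 2 ^ n * L * L)) := by
  have hL0 : 0 ≤ L := le_trans (by positivity) (hL 0 hn 0)
  have hT0 : 0 ≤ T := le_trans (by positivity) (hT 0)
  have hw0 : 0 < (1 + ‖z‖) ^ k := by positivity
  -- unweighted consequences
  have hLu : ∀ i < n, ∀ y : E × E, ‖iteratedFDeriv ℝ i g y‖ ≤ L := fun i hi =>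
    norm_iteratedFDeriv_le_of_weight (hL i hi)
  have hTu : ∀ y : E × E, ‖iteratedFDeriv ℝ n g y‖ ≤ T := norm_iteratedFDeriv_le_of_weight hT
  -- the weighted Leibniz sum at each `q`
  have hsum : ∀ q : E × sphere (0 : E) 1, (1 + ‖z‖) ^ k *
      ∑ i ∈ Finset.range (n + 1), (n.choose i : ℝ) * ‖iteratedFDeriv ℝ i g (z + shift₁ q)‖ *
        ‖iteratedFDeriv ℝ (n - i) g (z + shift₂ q)‖ ≤ 2 ^ (k + 1) * (2 * L * T + 2 ^ n * L * L) := by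
    intro q
    set z₁ := z + shift₁ q
    set z₂ := z + shift₂ q
    set x : ℕ → ℝ := fun i => ‖iteratedFDeriv ℝ i g z₁‖
    set y : ℕ → ℝ := fun i => ‖iteratedFDeriv ℝ i g z₂‖
    -- weight on the first factor
    have hA : (1 + ‖z₁‖) ^ k * ∑ i ∈ Finset.range (n + 1), (n.choose i : ℝ) * x i * y (n - i) ≤
        2 * L * T + 2 ^ n * L * L := by
      rw [Finset.mul_sum]
      have e : ∀ i ∈ Finset.range (n + 1), (1 + ‖z₁‖) ^ k * ((n.choose i : ℝ) * x i * y (n - i)) =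
          (n.choose i : ℝ) * ((1 + ‖z₁‖) ^ k * x i) * y (n - i) := fun i _ => by ring
      rw [Finset.sum_congr rfl e]
      refine (sum_choose_mul_le_ends (x := fun i => (1 + ‖z₁‖) ^ k * x i) (y := y)
        (fun i _ => by positivity) (fun i _ => norm_nonneg _) hL0 hL0
        (fun i _ hi => hL i hi z₁) (fun i h1 hi => hLu i hi z₂)).trans ?_
      have h0k : (1 + ‖z₁‖) ^ k * x 0 ≤ L := hL 0 hn z₁
      have hnk : (1 + ‖z₁‖) ^ k * x n ≤ T := hT z₁
      have hy0 : y 0 ≤ L := hLu 0 hn z₂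
      have hyn : y n ≤ T := hTu z₂
      have hx0 : 0 ≤ (1 + ‖z₁‖) ^ k * x 0 := by positivity
      have hxn : 0 ≤ (1 + ‖z₁‖) ^ k * x n := by positivity
      nlinarith [mul_le_mul h0k hyn (norm_nonneg _) hL0, mul_le_mul hnk hy0 (norm_nonneg _) hT0]
    -- weight on the second factor
    have hB' : (1 + ‖z₂‖) ^ k * ∑ i ∈ Finset.range (n + 1), (n.choose i : ℝ) * x i * y (n - i) ≤
        2 * L * T + 2 ^ n * L * L := by
      rw [Finset.mul_sum]
      have e : ∀ i ∈ Finset.range (n + 1), (1 + ‖z₂‖) ^ k * ((n.choose i : ℝ) * x i * y (n - i)) =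
          (n.choose i : ℝ) * x i * ((1 + ‖z₂‖) ^ k * y (n - i)) := fun i _ => by ring
      rw [Finset.sum_congr rfl e]
      refine (sum_choose_mul_le_ends (x := x) (y := fun i => (1 + ‖z₂‖) ^ k * y i)
        (fun i _ => norm_nonneg _) (fun i _ => by positivity) hL0 hL0
        (fun i h1 hi => hLu i hi z₁) (fun i _ hi => hL i hi z₂)).trans ?_
      have h0k : (1 + ‖z₂‖) ^ k * y 0 ≤ L := hL 0 hn z₂
      have hnk : (1 + ‖z₂‖) ^ k * y n ≤ T := hT z₂
      have hy0 : x 0 ≤ L := hLu 0 hn z₁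
      have hyn : x n ≤ T := hTu z₁
      have hx0 : 0 ≤ (1 + ‖z₂‖) ^ k * y 0 := by positivity
      have hxn : 0 ≤ (1 + ‖z₂‖) ^ k * y n := by positivity
      nlinarith [mul_le_mul hy0 hnk hxn hL0, mul_le_mul hyn h0k hx0 hT0]
    have hS0 : 0 ≤ ∑ i ∈ Finset.range (n + 1), (n.choose i : ℝ) * x i * y (n - i) :=
      Finset.sum_nonneg fun i _ => by positivity
    calc (1 + ‖z‖) ^ k * ∑ i ∈ Finset.range (n + 1), (n.choose i : ℝ) * x i * y (n - i)
        ≤ 2 ^ k * ((1 + ‖z₁‖) ^ k + (1 + ‖z₂‖) ^ k) *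
            ∑ i ∈ Finset.range (n + 1), (n.choose i : ℝ) * x i * y (n - i) :=
          mul_le_mul_of_nonneg_right (weight_le_add_shift z q k) hS0
      _ = 2 ^ k * ((1 + ‖z₁‖) ^ k * ∑ i ∈ Finset.range (n + 1), (n.choose i : ℝ) * x i * y (n - i) +
            (1 + ‖z₂‖) ^ k * ∑ i ∈ Finset.range (n + 1), (n.choose i : ℝ) * x i * y (n - i)) := by ring
      _ ≤ 2 ^ k * ((2 * L * T + 2 ^ n * L * L) + (2 * L * T + 2 ^ n * L * L)) := by gcongr
      _ = 2 ^ (k + 1) * (2 * L * T + 2 ^ n * L * L) := by rw [pow_succ]; ring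
  -- divide the weight into the bound `K`
  have hK : ∀ q : E × sphere (0 : E) 1, ∑ i ∈ Finset.range (n + 1), (n.choose i : ℝ) *
      ‖iteratedFDeriv ℝ i g (z + shift₁ q)‖ * ‖iteratedFDeriv ℝ (n - i) g (z + shift₂ q)‖ ≤
      2 ^ (k + 1) * (2 * L * T + 2 ^ n * L * L) / (1 + ‖z‖) ^ k := fun q => by
    rw [le_div_iff₀ hw0, mul_comm]
    exact hsum q
  have hmain := norm_iteratedFDeriv_gain_le_integral h hg hC n z hK
  calc (1 + ‖z‖) ^ k * ‖iteratedFDeriv ℝ n (gain B g) z‖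
      ≤ (1 + ‖z‖) ^ k * (kernelMass B * (2 ^ (k + 1) * (2 * L * T + 2 ^ n * L * L) / (1 + ‖z‖) ^ k)) :=
        mul_le_mul_of_nonneg_left hmain hw0.le
    _ = kernelMass B * (2 ^ (k + 1) * (2 * L * T + 2 ^ n * L * L)) := by
        field_simp

/-- **Weighted sup bound for the gain term** (order zero): if `(1 + ‖y‖)ᵏ |g(y)| ≤ Cₖ` and
`|g| ≤ C₀`, then `(1 + ‖z‖)ᵏ |gain (z)| ≤ ‖B‖₁ 2ᵏ⁺¹ Cₖ C₀` — linear in the weighted norm. [folklore] -/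
theorem weight_mul_abs_gain_le (h : KernelHyp B M R) {k : ℕ} {Ck C₀ : ℝ}
    (hk : ∀ y : E × E, (1 + ‖y‖) ^ k * |g y| ≤ Ck) (h0 : ∀ y : E × E, |g y| ≤ C₀) (z : E × E) :
    (1 + ‖z‖) ^ k * |gain B g z| ≤ kernelMass B * (2 ^ (k + 1) * Ck * C₀) := by
  have hC0 : 0 ≤ C₀ := (abs_nonneg _).trans (h0 0)
  have hCk : 0 ≤ Ck := le_trans (by positivity) (hk 0)
  have hw0 : 0 < (1 + ‖z‖) ^ k := by positivity
  have hpt : ∀ q : E × sphere (0 : E) 1, (1 + ‖z‖) ^ k * |g (z + shift₁ q) * g (z + shift₂ q)| ≤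
      2 ^ (k + 1) * Ck * C₀ := by
    intro q
    rw [abs_mul]
    have h1 := hk (z + shift₁ q)
    have h2 := hk (z + shift₂ q)
    have h3 := h0 (z + shift₁ q)
    have h4 := h0 (z + shift₂ q)
    have hw := weight_le_add_shift z q k
    have ha : 0 ≤ |g (z + shift₁ q)| := abs_nonneg _
    have hb : 0 ≤ |g (z + shift₂ q)| := abs_nonneg _
    calc (1 + ‖z‖) ^ k * (|g (z + shift₁ q)| * |g (z + shift₂ q)|)
        ≤ 2 ^ k * ((1 + ‖z + shift₁ q‖) ^ k + (1 + ‖z + shift₂ q‖) ^ k) *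
            (|g (z + shift₁ q)| * |g (z + shift₂ q)|) := mul_le_mul_of_nonneg_right hw (by positivity)
      _ = 2 ^ k * (((1 + ‖z + shift₁ q‖) ^ k * |g (z + shift₁ q)|) * |g (z + shift₂ q)| +
            |g (z + shift₁ q)| * ((1 + ‖z + shift₂ q‖) ^ k * |g (z + shift₂ q)|)) := by ring
      _ ≤ 2 ^ k * (Ck * C₀ + C₀ * Ck) := by
          gcongr
      _ = 2 ^ (k + 1) * Ck * C₀ := by rw [pow_succ]; ring
  have hbound : ∀ q : E × sphere (0 : E) 1, ‖g (z + shift₁ q) * g (z + shift₂ q)‖ ≤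
      2 ^ (k + 1) * Ck * C₀ / (1 + ‖z‖) ^ k := fun q => by
    rw [Real.norm_eq_abs, le_div_iff₀ hw0, mul_comm]
    exact hpt q
  have hmain := h.norm_integral_mul_le hbound
  rw [Real.norm_eq_abs] at hmain
  calc (1 + ‖z‖) ^ k * |gain B g z| ≤ (1 + ‖z‖) ^ k * (kernelMass B * (2 ^ (k + 1) * Ck * C₀ / (1 + ‖z‖) ^ k)) :=
        mul_le_mul_of_nonneg_left hmain hw0.le
    _ = kernelMass B * (2 ^ (k + 1) * Ck * C₀) := by field_simp

/-- The gain term of a nonnegative slice is nonnegative. [folklore] -/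
theorem gain_nonneg (h : KernelHyp B M R) (hg0 : ∀ z, 0 ≤ g z) (z : E × E) : 0 ≤ gain B g z :=
  integral_nonneg fun _ => mul_nonneg (h.nonneg _ _) (mul_nonneg (hg0 _) (hg0 _))

end Gain

/-! ## The local mass -/

section Mass

variable {g : E × E → ℝ} {C : ℕ → ℕ → ℝ}

omit [FiniteDimensional ℝ E] [MeasurableSpace E] [BorelSpace E] in
/-- The embedding `z ↦ (z.1, 0)` along which the mass integrand is evaluated. [folklore] -/
theorem mass_integrand_eq_comp_affine (g : E × E → ℝ) (w : E) :
    (fun z : E × E => g (z.1, w)) = fun z : E × E =>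
      g (((ContinuousLinearMap.inl ℝ E E).comp (ContinuousLinearMap.fst ℝ E E)) z + (0, w)) := by
  funext z
  simp

omit [FiniteDimensional ℝ E] [MeasurableSpace E] [BorelSpace E] in
/-- `‖inl ∘ fst‖ ≤ 1`. [folklore] -/
theorem norm_inl_comp_fst_le_one :
    ‖(ContinuousLinearMap.inl ℝ E E).comp (ContinuousLinearMap.fst ℝ E E)‖ ≤ 1 := by
  refine ContinuousLinearMap.opNorm_le_bound _ zero_le_one fun z => ?_
  simp only [ContinuousLinearMap.coe_comp, comp_apply, ContinuousLinearMap.coe_fst',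
    ContinuousLinearMap.inl_apply, one_mul, Prod.norm_mk, norm_zero]
  exact max_le (norm_fst_le z) (norm_nonneg _)

/-- The constant `J_d = ∫ (1 + ‖w‖)^{-(d+1)} dw < ∞`. [folklore] -/
theorem integrable_weight_inv :
    Integrable (fun w : E => (1 + ‖w‖) ^ (-((Module.finrank ℝ E : ℝ) + 1))) (volume : Measure E) :=
  integrable_one_add_norm (by linarith)

omit [FiniteDimensional ℝ E] [MeasurableSpace E] [BorelSpace E] in
/-- Pointwise decay in the velocity variable from the weighted bounds:
`‖Dⁿ g (x, w)‖ ≤ C n (d+1) (1 + ‖w‖)^{-(d+1)}`. [folklore] -/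
theorem norm_iteratedFDeriv_le_weight_inv {n : ℕ} {T : ℝ}
    (hT : ∀ y : E × E, (1 + ‖y‖) ^ (Module.finrank ℝ E + 1) * ‖iteratedFDeriv ℝ n g y‖ ≤ T)
    (x w : E) :
    ‖iteratedFDeriv ℝ n g (x, w)‖ ≤ T * (1 + ‖w‖) ^ (-((Module.finrank ℝ E : ℝ) + 1)) := by
  have hT0 : 0 ≤ T := le_trans (by positivity) (hT 0)
  have hw : 0 < 1 + ‖w‖ := by positivity
  have hle : (1 + ‖w‖) ^ (Module.finrank ℝ E + 1) ≤ (1 + ‖((x, w) : E × E)‖) ^ (Module.finrank ℝ E + 1) :=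
    pow_le_pow_left₀ hw.le (by simp [Prod.norm_def]) _
  have h1 : (1 + ‖w‖) ^ (Module.finrank ℝ E + 1) * ‖iteratedFDeriv ℝ n g (x, w)‖ ≤ T :=
    le_trans (mul_le_mul_of_nonneg_right hle (norm_nonneg _)) (hT (x, w))
  have hrpow : (1 + ‖w‖) ^ (-((Module.finrank ℝ E : ℝ) + 1)) = ((1 + ‖w‖) ^ (Module.finrank ℝ E + 1))⁻¹ := by
    rw [Real.rpow_neg hw.le, ← Real.rpow_natCast]
    push_cast
    ring_nf
  rw [hrpow, ← div_eq_mul_inv, le_div_iff₀ (by positivity), mul_comm]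
  exact h1

/-- The hypotheses of iterated differentiation under the integral sign for the mass integrand
`w ↦ (z ↦ g(z.1, w))`. [folklore] -/
theorem mass_family (hg : ContDiff ℝ ∞ g)
    (hC : ∀ (n k : ℕ) (z : E × E), (1 + ‖z‖) ^ k * ‖iteratedFDeriv ℝ n g z‖ ≤ C n k) :
    (∀ w : E, ContDiff ℝ ∞ fun z : E × E => g (z.1, w)) ∧
    (∀ (n : ℕ) (z : E × E), AEStronglyMeasurable (fun w : E =>
      iteratedFDeriv ℝ n (fun z : E × E => g (z.1, w)) z) volume) ∧
    (∀ n : ℕ, ∃ G : E → ℝ, Integrable G volume ∧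
      ∀ w z, ‖iteratedFDeriv ℝ n (fun z : E × E => g (z.1, w)) z‖ ≤ G w) := by
  set L := (ContinuousLinearMap.inl ℝ E E).comp (ContinuousLinearMap.fst ℝ E E) with hL
  refine ⟨fun w => hg.comp (contDiff_fst.prodMk contDiff_const), fun n z => ?_, fun n => ?_⟩
  · simp_rw [mass_integrand_eq_comp_affine g]
    exact (continuous_iteratedFDeriv_comp_affine_param hg L
      (continuous_const.prodMk continuous_id : Continuous fun w : E => ((0 : E), w)) n z).aestronglyMeasurable
  · refine ⟨fun w => C n (Module.finrank ℝ E + 1) * (1 + ‖w‖) ^ (-((Module.finrank ℝ E : ℝ) + 1)),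
      integrable_weight_inv.const_mul _, fun w z => ?_⟩
    rw [mass_integrand_eq_comp_affine g]
    refine (norm_iteratedFDeriv_comp_affine_le_of_norm_le_one hg norm_inl_comp_fst_le_one _
      (mod_cast le_top) z).trans ?_
    have e : L z + (0, w) = (z.1, w) := by simp [hL]
    rw [e]
    exact norm_iteratedFDeriv_le_weight_inv (fun y => hC n _ y) z.1 w

/-- **The local mass of a Schwartz-type slice is smooth** (as a function on phase space,
constant in the velocity variable). [folklore] -/
theorem contDiff_mass (hg : ContDiff ℝ ∞ g)
    (hC : ∀ (n k : ℕ) (z : E × E), (1 + ‖z‖) ^ k * ‖iteratedFDeriv ℝ n g z‖ ≤ C n k) :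
    ContDiff ℝ ∞ (mass g) := by
  obtain ⟨h1, h2, h3⟩ := mass_family hg hC
  exact contDiff_integral_of_dominated_iteratedFDeriv h1 h2 h3

/-- **Derivative bound for the local mass**: `‖Dⁿ mass (z)‖ ≤ J_d T` whenever
`(1 + ‖y‖)^{d+1} ‖Dⁿ g (y)‖ ≤ T`, `J_d = ∫ (1 + ‖w‖)^{-(d+1)} dw`. [folklore] -/
theorem norm_iteratedFDeriv_mass_le (hg : ContDiff ℝ ∞ g)
    (hC : ∀ (n k : ℕ) (z : E × E), (1 + ‖z‖) ^ k * ‖iteratedFDeriv ℝ n g z‖ ≤ C n k)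
    {n : ℕ} {T : ℝ}
    (hT : ∀ y : E × E, (1 + ‖y‖) ^ (Module.finrank ℝ E + 1) * ‖iteratedFDeriv ℝ n g y‖ ≤ T)
    (z : E × E) :
    ‖iteratedFDeriv ℝ n (mass g) z‖ ≤
      (∫ w : E, (1 + ‖w‖) ^ (-((Module.finrank ℝ E : ℝ) + 1))) * T := by
  obtain ⟨h1, h2, h3⟩ := mass_family hg hC
  rw [show mass g = fun z => ∫ w, g (z.1, w) from rfl, mul_comm, ← integral_const_mul]
  refine norm_iteratedFDeriv_integral_le h1 h2 h3 (integrable_weight_inv.const_mul T) fun w => ?_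
  rw [mass_integrand_eq_comp_affine g]
  refine (norm_iteratedFDeriv_comp_affine_le_of_norm_le_one hg norm_inl_comp_fst_le_one _
    (mod_cast le_top) z).trans ?_
  have e : ((ContinuousLinearMap.inl ℝ E E).comp (ContinuousLinearMap.fst ℝ E E)) z + (0, w) = (z.1, w) := by
    simp
  rw [e]
  exact norm_iteratedFDeriv_le_weight_inv hT z.1 w

/-- The mass integrand of a Schwartz-type slice is integrable. [folklore] -/
theorem integrable_mass_integrand (hg : ContDiff ℝ ∞ g)
    (hC : ∀ (n k : ℕ) (z : E × E), (1 + ‖z‖) ^ k * ‖iteratedFDeriv ℝ n g z‖ ≤ C n k) (x : E) :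
    Integrable (fun w : E => g (x, w)) volume := by
  refine (integrable_weight_inv.const_mul (C 0 (Module.finrank ℝ E + 1))).mono'
    ((hg.continuous.comp (continuous_const.prodMk continuous_id)).aestronglyMeasurable)
    (Eventually.of_forall fun w => ?_)
  have := norm_iteratedFDeriv_le_weight_inv (fun y => hC 0 _ y) x w
  rwa [norm_iteratedFDeriv_zero] at this

/-- The local mass of a nonnegative slice is nonnegative. [folklore] -/
theorem mass_nonneg (hg0 : ∀ z, 0 ≤ g z) (z : E × E) : 0 ≤ mass g z :=
  integral_nonneg fun _ => hg0 _

/-- The local mass is bounded: `mass (z) ≤ J_d T` if `(1 + ‖y‖)^{d+1} |g(y)| ≤ T`. [folklore] -/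
theorem mass_le (hg : ContDiff ℝ ∞ g)
    (hC : ∀ (n k : ℕ) (z : E × E), (1 + ‖z‖) ^ k * ‖iteratedFDeriv ℝ n g z‖ ≤ C n k)
    {T : ℝ} (hT : ∀ y : E × E, (1 + ‖y‖) ^ (Module.finrank ℝ E + 1) * |g y| ≤ T) (z : E × E) :
    mass g z ≤ (∫ w : E, (1 + ‖w‖) ^ (-((Module.finrank ℝ E : ℝ) + 1))) * T := by
  have hT' : ∀ y : E × E, (1 + ‖y‖) ^ (Module.finrank ℝ E + 1) * ‖iteratedFDeriv ℝ 0 g y‖ ≤ T := fun y => by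
    rw [norm_iteratedFDeriv_zero, Real.norm_eq_abs]; exact hT y
  have := norm_iteratedFDeriv_mass_le hg hC hT' z
  rw [norm_iteratedFDeriv_zero, Real.norm_eq_abs] at this
  exact (le_abs_self _).trans this

end Mass

/-! ## The normalising factor, the absorption and the source -/

section Norm

variable {B : E × E → sphere (0 : E) 1 → ℝ} {M R : ℝ} {g : E × E → ℝ} {C : ℕ → ℕ → ℝ} {δ : ℝ}

/-- The normalising factor of a nonnegative Schwartz-type slice is smooth. [folklore] -/
theorem contDiff_normFactor (hδ : 0 ≤ δ) (hg : ContDiff ℝ ∞ g) (hg0 : ∀ z, 0 ≤ g z)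
    (hC : ∀ (n k : ℕ) (z : E × E), (1 + ‖z‖) ^ k * ‖iteratedFDeriv ℝ n g z‖ ≤ C n k) :
    ContDiff ℝ ∞ (normFactor δ g) :=
  contDiff_inv_one_add (contDiff_mass hg hC) hδ (mass_nonneg hg0)

/-- `0 < normFactor ≤ 1`. [folklore] -/
theorem normFactor_pos_le_one (hδ : 0 ≤ δ) (hg0 : ∀ z, 0 ≤ g z) (z : E × E) :
    0 < normFactor δ g z ∧ normFactor δ g z ≤ 1 := by
  have h := mass_nonneg hg0 z
  refine ⟨inv_pos.2 (by nlinarith), inv_le_one_of_one_le₀ (by nlinarith)⟩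

/-- `normFactor · (δ mass) ≤ 1`: the normalisation makes the quadratic collision term grow at
most linearly (CIP 1994 (3.18)–(3.19)). [cite: CIPDiluteGases1994, §5.3 (3.18)] -/
theorem normFactor_mul_mass_le (hδ : 0 ≤ δ) (hg0 : ∀ z, 0 ≤ g z) (z : E × E) :
    normFactor δ g z * (δ * mass g z) ≤ 1 := by
  have h := mass_nonneg hg0 z
  have hpos : 0 < 1 + δ * mass g z := by nlinarith
  rw [normFactor, inv_mul_le_iff₀ hpos]
  linarith

/-- The absorption coefficient of a nonnegative Schwartz-type slice is smooth. [folklore] -/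
theorem contDiff_absorption (h : KernelHyp B M R) (hδ : 0 ≤ δ) (hg : ContDiff ℝ ∞ g)
    (hg0 : ∀ z, 0 ≤ g z)
    (hC : ∀ (n k : ℕ) (z : E × E), (1 + ‖z‖) ^ k * ‖iteratedFDeriv ℝ n g z‖ ≤ C n k) :
    ContDiff ℝ ∞ (absorption δ B g) :=
  (contDiff_normFactor hδ hg hg0 hC).mul (contDiff_loss h hg hC)

/-- The source of a nonnegative Schwartz-type slice is smooth. [folklore] -/
theorem contDiff_source (h : KernelHyp B M R) (hδ : 0 ≤ δ) (hg : ContDiff ℝ ∞ g)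
    (hg0 : ∀ z, 0 ≤ g z)
    (hC : ∀ (n k : ℕ) (z : E × E), (1 + ‖z‖) ^ k * ‖iteratedFDeriv ℝ n g z‖ ≤ C n k) :
    ContDiff ℝ ∞ (source δ B g) :=
  (contDiff_normFactor hδ hg hg0 hC).mul (contDiff_gain h hg hC)

/-- `0 ≤ absorption ≤ ‖B‖₁ C₀`. [folklore] -/
theorem absorption_nonneg_le (h : KernelHyp B M R) (hδ : 0 ≤ δ) (hgc : Continuous g)
    (hg0 : ∀ z, 0 ≤ g z) {C₀ : ℝ} (h0 : ∀ y, |g y| ≤ C₀) (z : E × E) :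
    0 ≤ absorption δ B g z ∧ absorption δ B g z ≤ kernelMass B * C₀ := by
  obtain ⟨hp, hle⟩ := normFactor_pos_le_one hδ hg0 z
  have hl := loss_nonneg h hg0 z
  refine ⟨mul_nonneg hp.le hl, ?_⟩
  calc absorption δ B g z ≤ 1 * loss B g z := mul_le_mul_of_nonneg_right hle hl
    _ ≤ kernelMass B * C₀ := by rw [one_mul]; exact loss_le h hgc h0 z

/-- `0 ≤ source`. [folklore] -/
theorem source_nonneg (h : KernelHyp B M R) (hδ : 0 ≤ δ) (hg0 : ∀ z, 0 ≤ g z) (z : E × E) :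
    0 ≤ source δ B g z :=
  mul_nonneg (normFactor_pos_le_one hδ hg0 z).1.le (gain_nonneg h hg0 z)

/-- **Weighted sup bound for the source** (order zero): `(1 + ‖z‖)ᵏ source (z) ≤ ‖B‖₁ 2ᵏ⁺¹ Cₖ C₀`,
linear in the weighted sup norm `Cₖ` of `g`. [folklore] -/
theorem weight_mul_source_le (h : KernelHyp B M R) (hδ : 0 ≤ δ)
    (hg0 : ∀ z, 0 ≤ g z) {k : ℕ} {Ck C₀ : ℝ} (hk : ∀ y : E × E, (1 + ‖y‖) ^ k * |g y| ≤ Ck)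
    (h0 : ∀ y : E × E, |g y| ≤ C₀) (z : E × E) :
    (1 + ‖z‖) ^ k * source δ B g z ≤ kernelMass B * (2 ^ (k + 1) * Ck * C₀) := by
  obtain ⟨hp, hle⟩ := normFactor_pos_le_one hδ hg0 z
  have hga := gain_nonneg h hg0 z
  calc (1 + ‖z‖) ^ k * source δ B g z ≤ (1 + ‖z‖) ^ k * (1 * gain B g z) := by
        refine mul_le_mul_of_nonneg_left (mul_le_mul_of_nonneg_right hle hga) (by positivity)
    _ = (1 + ‖z‖) ^ k * |gain B g z| := by rw [one_mul, abs_of_nonneg hga]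
    _ ≤ _ := weight_mul_abs_gain_le h hk h0 z

end Norm

end TruncPicard

end Literature.MathematicalPhysics.KineticTheory
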